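import Summits.CriticalPhenomena.PercolationContinuityZ3.Theorems.Transplant.FKConnectivityAllQAntipodalTwoSpineBridge
import Summits.CriticalPhenomena.PercolationContinuityZ3.Theorems.Transplant.FKConnectivityAllQAntipodalTwoSpineRule
import HarnessLib

/-!
# Conjecture U¹¹ at every SERIES split node: `apUpcSplit q (A ∪ B) s t y z h ≥ 0` (`0 < q ≤ 1`)

Helper file (`--supports stmt-CriticalPhenomena-4575`), FK sub-lane `prim-bschramm-fk-2` (gen 16); builds on p205010 (kernel theorem,
internal audit signed; external expert review pending).  No named facts, no sorries, standard axioms.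

Memo `bschramm/FROM-fk-2-g15-TWO-SPINE.md` §12 and blueprint `prim-bschramm-fk-2-g15/BLUEPRINT-U11-LEAN.md` L1/L2/L4.
**`FK.TwoSpine.apUpcSplit_series_core_nonneg`**: let `A` be a two-terminal series–parallel network between `s` and `m` grown from the
marked edge `y = y₁y₂` along a spine `psA` (`FK.IsSpine psA {y} y₁ y₂ A s m`), `B` one between `m` and `t` grown from `z = z₁z₂` along
`psB`, edge-disjoint with vertex spans meeting only in the cut vertex `m` (the series composition `A · B`, a SERIES SPLIT NODE of the
marked pair); then for `0 < q ≤ 1` and every `h` monotone on the sub-configurations of `A ∪ B` and not reading `y, z`,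
`0 ≤ apUpcSplit q (A ∪ B) s t y z h` — gen 11's CONJECTURE U¹¹ at every series split node, for all spine shapes.
PROOF: shift `h` by a constant to make it nonnegative (`apUpcSplit_add_const`: the functional only sees differences); the semantic
bridge `apUpcSplit_series_bridge` (`…TwoSpineBridge`) turns `q^{c} · U¹¹(A·B)` into `q^{4|V|} ·` the root sum of the two-spine word model
against the two-spine fibre sums, which form an admissible family (`admissible_fiber2`, Theorem U part by part); the RULE THEOREM
`dstmt_root_W` (`…TwoSpineRule`: gen 15's explicit certificate rule, valid for all shapes) says that root sum is `≥ 0`.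
[cite: Grimmett2006, §1.4 eq. (1.20) (p. 15); §3.8 (pp. 61–62); §3.9 (p. 63)]
-/

noncomputable section

namespace Summit.CriticalPhenomena.PercolationContinuityZ3.Theorems

namespace FK

namespace TwoSpine

open SimpleGraph Literature.Probability.LatticeModels Literature.Probability.Percolation X2Word
open scoped Classical

variable {V : Type*} [Fintype V]

omit [Fintype V] in
/-- The split indicator is symmetric under complementation inside `E` (both marked edges in `E`). [folklore] -/
theorem splitInd_compl {E γ : Finset (Sym2 V)} {y z : Sym2 V} (hy : y ∈ E) (hz : z ∈ E) :
    splitInd y z (E \ γ) = splitInd y z γ := by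
  unfold splitInd
  by_cases hyγ : y ∈ γ <;> by_cases hzγ : z ∈ γ <;> simp [Finset.mem_sdiff, hy, hz, hyγ, hzγ]

omit [Fintype V] in
/-- **`U¹¹` only sees differences**: shifting the test function by a constant does not change `apUpcSplit` (the symmetry `γ ↦ E ∖ γ`
reverses the sign of the summand's connection factor and preserves the rest). [folklore] -/
theorem apUpcSplit_add_const (q : ℝ) {E : Finset (Sym2 V)} {y z : Sym2 V} (hy : y ∈ E) (hz : z ∈ E) (s t : V)
    (h : Finset (Sym2 V) → ℝ) (c : ℝ) :
    apUpcSplit q E s t y z (fun γ => h γ + c) = apUpcSplit q E s t y z h := by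
  unfold apUpcSplit
  have hZ : ∑ γ ∈ E.powerset, q ^ apExp E γ * (splitInd y z γ * ((apConn γ s t - apConn (E \ γ) s t) * c)) = 0 := by
    have flip := sum_powerset_flip E (fun γ => q ^ apExp E γ * (splitInd y z γ * ((apConn γ s t - apConn (E \ γ) s t) * c)))
    have e : ∑ γ ∈ E.powerset, q ^ apExp E (E \ γ) * (splitInd y z (E \ γ) * ((apConn (E \ γ) s t - apConn (E \ (E \ γ)) s t) * c)) =
        -∑ γ ∈ E.powerset, q ^ apExp E γ * (splitInd y z γ * ((apConn γ s t - apConn (E \ γ) s t) * c)) := by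
      rw [← Finset.sum_neg_distrib]
      refine Finset.sum_congr rfl fun γ hγ => ?_
      have hγE := Finset.mem_powerset.1 hγ
      rw [Finset.sdiff_sdiff_eq_self hγE, apExp_compl hγE, splitInd_compl hy hz]
      ring
    linarith
  have hsplit : ∑ γ ∈ E.powerset, q ^ apExp E γ * (splitInd y z γ * ((apConn γ s t - apConn (E \ γ) s t) * (h γ + c))) =
      ∑ γ ∈ E.powerset, q ^ apExp E γ * (splitInd y z γ * ((apConn γ s t - apConn (E \ γ) s t) * h γ)) +
        ∑ γ ∈ E.powerset, q ^ apExp E γ * (splitInd y z γ * ((apConn γ s t - apConn (E \ γ) s t) * c)) := by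
    rw [← Finset.sum_add_distrib]
    exact Finset.sum_congr rfl fun γ _ => by ring
  rw [hsplit, hZ, add_zero]

section Core

variable {psA psB : List (SpinePart V)} {A B : Finset (Sym2 V)} {V₁ V₂ : Set V} {y₁ y₂ z₁ z₂ s m t : V}

/-- **CONJECTURE U¹¹ AT EVERY SERIES SPLIT NODE** (`0 < q ≤ 1`, all spine shapes): for the series composition `A · B` at the cut
vertex `m` of a network `A ∋ y` (between `s, m`) and a network `B ∋ z` (between `m, t`), each two-terminal series–parallel and grown from
its marked edge along a spine, and every `h` monotone on the sub-configurations of `A ∪ B` not reading `y, z`: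
`0 ≤ apUpcSplit q (A ∪ B) s t y z h`.  (Gen 15's two-spine rule theorem + the semantic bridge.) [cite: Grimmett2006, §3.9 (p. 63)] -/
theorem apUpcSplit_series_core_nonneg {q : ℝ} (hq0 : 0 < q) (hq1 : q ≤ 1)
    (hA : IsSpine psA {s(y₁, y₂)} y₁ y₂ A s m) (hB : IsSpine psB {s(z₁, z₂)} z₁ z₂ B m t)
    (hy : y₁ ≠ y₂) (hz : z₁ ≠ z₂) (hd : Disjoint A B)
    (h₁ : ∀ e ∈ (↑A : Set (Sym2 V)), ∀ x ∈ e, x ∈ V₁) (h₂ : ∀ e ∈ (↑B : Set (Sym2 V)), ∀ x ∈ e, x ∈ V₂)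
    (hS : V₁ ∩ V₂ ⊆ {m}) (hsV₂ : s ∉ V₂) (htV₁ : t ∉ V₁) (hsm : s ≠ m) (htm : t ≠ m) (hst : s ≠ t)
    {h : Finset (Sym2 V) → ℝ} (hmono : ∀ ⦃C D : Finset (Sym2 V)⦄, C ⊆ D → D ⊆ A ∪ B → h C ≤ h D)
    (hhy : ∀ C, h (insert s(y₁, y₂) C) = h C) (hhz : ∀ C, h (insert s(z₁, z₂) C) = h C) :
    0 ≤ apUpcSplit q (A ∪ B) s t s(y₁, y₂) s(z₁, z₂) h := by
  have hyA : s(y₁, y₂) ∈ A := marked_mem hA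
  have hzB : s(z₁, z₂) ∈ B := marked_mem hB
  -- normalise the test function: `h' = h - h ∅ ≥ 0` on the sub-configurations
  rw [← apUpcSplit_add_const q (Finset.mem_union_left B hyA) (Finset.mem_union_right A hzB) s t h (-h ∅)]
  have hhy' : ∀ C, (fun γ => h γ + -h ∅) (insert s(y₁, y₂) C) = (fun γ => h γ + -h ∅) C := fun C => by simp only [hhy]
  have hhz' : ∀ C, (fun γ => h γ + -h ∅) (insert s(z₁, z₂) C) = (fun γ => h γ + -h ∅) C := fun C => by simp only [hhz]
  have hsub : A.erase s(y₁, y₂) ∪ B.erase s(z₁, z₂) ⊆ A ∪ B :=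
    Finset.union_subset_union (Finset.erase_subset _ _) (Finset.erase_subset _ _)
  have hmono' : ∀ ⦃C D : Finset (Sym2 V)⦄, C ⊆ D → D ⊆ A.erase s(y₁, y₂) ∪ B.erase s(z₁, z₂) →
      (fun γ => h γ + -h ∅) C ≤ (fun γ => h γ + -h ∅) D := by
    intro C D hCD hD
    simp only [add_le_add_iff_right]
    exact hmono hCD (hD.trans hsub)
  have hnn' : ∀ C ⊆ A.erase s(y₁, y₂) ∪ B.erase s(z₁, z₂), 0 ≤ (fun γ => h γ + -h ∅) C := by
    intro C hC
    have := hmono (Finset.empty_subset C) (hC.trans hsub)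
    simp only
    linarith
  -- the bridge and the rule theorem
  have key := apUpcSplit_series_bridge q hA hB hy hz hd h₁ h₂ hS hsV₂ htV₁ hsm htm hst (h := fun γ => h γ + -h ∅) hhy' hhz'
  have hadm := admissible_fiber2 hq0 hA.pairwise_disjoint hA.parts_isTTSP (hA.cover_erase subset_rfl)
    hB.pairwise_disjoint hB.parts_isTTSP (hB.cover_erase subset_rfl) hmono' hnn' [((Mode.o, Mode.o, Mode.o, Mode.o), 0)]
  have hds := dstmt_root_W hq0.le hq1 (psA.map (·.kind)) (psB.map (·.kind)) _ hadm
  have hpos : 0 < q ^ (2 + 2 * ((1 + psA.length + psB.length) * Fintype.card V)) := pow_pos hq0 _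
  refine (mul_nonneg_iff_of_pos_left hpos).1 ?_
  rw [key]
  exact mul_nonneg (pow_nonneg hq0.le _) hds

/-- **`U¹¹ ≥ 0` for every network whose split node is a SERIES node**: if `(E; s', t')` is obtained from the series core `A · B` above by
gluing further two-terminal series–parallel parts (`FK.IsSpine ps (A ∪ B) s t E s' t'` — the decomposition nodes above the split node),
then `0 ≤ apUpcSplit q E s' t' y z h` for every `h` monotone on the sub-configurations of `E` not reading `y, z` (gen 14's closure
lemmas `FK.IsSpine.apUpcSplit_nonneg` on top of the core theorem). [cite: Grimmett2006, §3.8 Thm. (3.90) (pp. 61–62); §3.9 (p. 63)] -/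
theorem apUpcSplit_nonneg_of_series_core {q : ℝ} (hq0 : 0 < q) (hq1 : q ≤ 1)
    (hA : IsSpine psA {s(y₁, y₂)} y₁ y₂ A s m) (hB : IsSpine psB {s(z₁, z₂)} z₁ z₂ B m t)
    (hy : y₁ ≠ y₂) (hz : z₁ ≠ z₂) (hd : Disjoint A B)
    (h₁ : ∀ e ∈ (↑A : Set (Sym2 V)), ∀ x ∈ e, x ∈ V₁) (h₂ : ∀ e ∈ (↑B : Set (Sym2 V)), ∀ x ∈ e, x ∈ V₂)
    (hS : V₁ ∩ V₂ ⊆ {m}) (hsV₂ : s ∉ V₂) (htV₁ : t ∉ V₁) (hsm : s ≠ m) (htm : t ≠ m) (hst : s ≠ t)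
    {ps : List (SpinePart V)} {E : Finset (Sym2 V)} {s' t' : V} (hsp : IsSpine ps (A ∪ B) s t E s' t')
    {h : Finset (Sym2 V) → ℝ} (hmono : ∀ ⦃C D : Finset (Sym2 V)⦄, C ⊆ D → D ⊆ E → h C ≤ h D)
    (hhy : ∀ C, h (insert s(y₁, y₂) C) = h C) (hhz : ∀ C, h (insert s(z₁, z₂) C) = h C) :
    0 ≤ apUpcSplit q E s' t' s(y₁, y₂) s(z₁, z₂) h :=
  hsp.apUpcSplit_nonneg hq0 hst (Finset.mem_union_left B (marked_mem hA)) (Finset.mem_union_right A (marked_mem hB))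
    (fun _ hmono' hhy' hhz' => apUpcSplit_series_core_nonneg hq0 hq1 hA hB hy hz hd h₁ h₂ hS hsV₂ htV₁ hsm htm hst hmono' hhy' hhz')
    h hmono hhy hhz

end Core

end TwoSpine

end FK

end Summit.CriticalPhenomena.PercolationContinuityZ3.Theorems

end
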